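import Literature.AnabelianGeometry.SemiGraphs.QuotientApproximatorBranches
import Literature.AnabelianGeometry.SemiGraphs.SurfaceTypeQuasiCoherent
import Literature.AnabelianGeometry.SemiGraphs.ProSigmaCompletionInjective
import Literature.GroupTheory.CombinatorialGroupTheory.PuncturedSurfaceGroupTripodQuotient

/-!
# Semi-graphs of anabelioids of surface type are totally elevated ([SemiAnbd] Ex. 2.10)

Mochizuki, *Semi-graphs of anabelioids*, Publ. RIMS **42** (2006), Example 2.10 p. 31: the
semi-graph of anabelioids of a pointed stable curve "is coherent, totally elevated, …" ("one
verifies immediately … from the well-known structure of fundamental groups of hyperbolic Riemann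
surfaces of finite type") [cite: MochizukiSemiAnbd2006, Ex. 2.10 p.31].  This proof-only file (cell
abc-iut, layer L3, row G31 (2), seat abc-iut-L3-t4) proves conjunct (2) of abc-iut-L3-t1's named fact
`example_2_10` (`Coverticial.lean`, binder `EveryEdgeAbuts` of ruling σ2): a semi-graph of
anabelioids of surface type in which every edge abuts to a vertex is totally elevated
([SemiAnbd] Def. 2.4 (i) p. 25: for every `M ≥ 1` a `π₁`-epimorphic approximator `𝒢 → 𝒢'` and a
subgroup `N_M ⊆ π̂₁(𝒢'_v)` of order `≥ M` meeting every conjugate of every `Π'_b`, `b` abutting to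
`v`, trivially — for every basepoint and representative).

Proof.  Fix `v₀`, `M ≥ 1`, a prime `p ∈ Σ`, `k := M`, `n := p ^ (k+1)`.  Group theory
(`PuncturedSurfaceGroup.exists_hom_cuspOrder_avoiding`, abc-iut-L3-t4): a finite `p`-group quotient
`f : Γ_{g,r} ↠ f(Γ) ⊆ Q` of the surface group at `v₀` in which every cusp generator has order
exactly `n` and a subgroup `N ⊆ f(Γ)` of order `≥ p ^ k ≥ M` avoids all conjugates of all
`⟨f(c_j)⟩`.  By the universal property of the pro-`Σ` completion `ι : Γ → Π_{v₀}`, `ker f` is the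
pull-back of an open normal `W_{v₀} ⊴ Π_{v₀}` with `Π_{v₀}/W_{v₀} ≅ f(Γ)`, meeting every (closed,
procyclic) branch group `Π_b` in the closure of its `n`-th powers
(`IsProSigmaCompletion.exists_open_normal_elevated`).  At every other vertex the uniform cusp-order
subgroups of `SurfaceTypeCuspQuotients` do the same with index `∣ n³`; on the edges one takes the
closed normal subgroup generated by the `n`-th powers, which is the pull-back of `W_v` along every
branch (`compat_of_inter_branchSubgroup`).  The quotient approximator with its branch subgroups
(`exists_quotientApproximator_branches`) then exhibits, at any basepoint `F'` of `𝒢'_{v₀}`, the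
branch groups as conjugates of the images `θ(Π_b)`, `θ : Π_{v₀} ↠ Aut F' = Π_{v₀}/W_{v₀}`, and the
image of `N` avoids all their conjugates.  No statement here takes a side on any disputed claim.
-/

namespace Literature.AnabelianGeometry.SemiGraphs.SemiGraphOfAnabelioids.IsProSigmaCompletion

open Literature.AnabelianGeometry.Anabelioids Topology Pointwise
open Literature.GroupTheory.CombinatorialGroupTheory
open Literature.GroupTheory.CombinatorialGroupTheory.PuncturedSurfaceGroup

variable {Sigma : Set ℕ} {g r : ℕ} {P : Type*} [Group P] [TopologicalSpace P]
  [IsTopologicalGroup P] [CompactSpace P] [TotallyDisconnectedSpace P]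
  {ι : PuncturedSurfaceGroup g r →* P}

omit [CompactSpace P] [TotallyDisconnectedSpace P] in
/-- **Elevation quotients of a pro-`Σ` surface group.** Let `ι : Γ_{g,r} → P` be a pro-`Σ`
completion of a hyperbolic punctured surface group, `p ∈ Σ` a prime and `k : ℕ`.  There are an open
normal `W ⊴ P` of `p`-power index meeting the closure of every cusp inertia group `ι⟨c_j⟩` in the
closure of `ι⟨c_j ^ p^(k+1)⟩`, and a subgroup `W ⊆ N₁ ⊆ P` with `p ^ k · [P : N₁] ≤ [P : W]` (i.e.
`|N₁/W| ≥ p ^ k`) such that `N₁ ∩ γ B γ⁻¹ ⊆ W` for every `γ ∈ P` and every subgroup `B` of the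
closure of some `ι⟨c_j⟩`: in `P/W` the image of `N₁` has order `≥ p ^ k` and meets every conjugate of
every cusp inertia image trivially ([SemiAnbd] Def. 2.4 (i) for Ex. 2.10).
[cite: MochizukiSemiAnbd2006, Ex. 2.10 p.31] -/
theorem exists_open_normal_elevated (hι : IsProSigmaCompletion Sigma ι) (h : IsHyperbolicType g r)
    {p : ℕ} (hp : p.Prime) (hpS : p ∈ Sigma) (k : ℕ) :
    ∃ (W : Subgroup P) (a : ℕ), IsOpen (W : Set P) ∧ W.Normal ∧ W.index ∣ p ^ a ∧
      (∀ j, (W : Set P) ∩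
          closure (ι '' ((cuspInertia (g := g) j : Subgroup (PuncturedSurfaceGroup g r)) :
            Set (PuncturedSurfaceGroup g r))) =
        closure (ι '' ((Subgroup.zpowers (c (g := g) j ^ p ^ (k + 1)) :
          Subgroup (PuncturedSurfaceGroup g r)) : Set (PuncturedSurfaceGroup g r)))) ∧
      ∃ N₁ : Subgroup P, W ≤ N₁ ∧ p ^ k * N₁.index ≤ W.index ∧
        ∀ (j : Fin r) (B : Subgroup P),
          (B : Set P) ⊆ closure (ι '' ((cuspInertia (g := g) j :
            Subgroup (PuncturedSurfaceGroup g r)) : Set (PuncturedSurfaceGroup g r))) →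
          ∀ γ : P, N₁ ⊓ ConjAct.toConjAct γ • B ≤ W := by
  obtain ⟨Q, _, _, f, N, ⟨a, hQ⟩, hord, hNle, hNcard, hNav⟩ :=
    exists_hom_cuspOrder_avoiding (g := g) h hp k
  -- `ker f` has `p`-power, hence `Σ`-integer, index: it is the pull-back of an open normal `W`
  have hKidx : f.ker.index ∣ p ^ a := (index_ker_dvd_card f).trans hQ
  have hKS : IsSigmaInteger Sigma f.ker.index := (isSigmaInteger_prime_pow hp hpS a).of_dvd hKidx
  obtain ⟨W, hWo, hWK⟩ := hι.comap_surj f.ker inferInstance hKS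
  have hWn : W.Normal := normal_of_comap_normal hι W hWo (by rw [hWK]; infer_instance)
  haveI := hWn
  have hWidx : W.index = f.ker.index := by rw [← index_comap_of_normal hι W hWo, hWK]
  haveI : W.FiniteIndex := ⟨by rw [hWidx]; exact hKS.1.ne'⟩
  haveI : Finite (P ⧸ W) := Subgroup.finite_quotient_of_finiteIndex
  -- the comparison `Λ : P/W → Q`: injective, `Λ ∘ π ∘ ι = f`
  let π : P →* P ⧸ W := QuotientGroup.mk' W
  let E₁ : PuncturedSurfaceGroup g r ⧸ W.comap ι ≃* P ⧸ W :=
    MulEquiv.ofBijective (QuotientGroup.map (W.comap ι) W ι le_rfl) (bijective_quotientMap hι W hWo)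
  let e₂ : PuncturedSurfaceGroup g r ⧸ W.comap ι →* Q := QuotientGroup.lift (W.comap ι) f hWK.le
  let Λ : P ⧸ W →* Q := e₂.comp E₁.symm.toMonoidHom
  have hE₁ : ∀ γ, π (ι γ) = E₁ (QuotientGroup.mk γ) := fun γ => rfl
  have hΛ : ∀ γ, Λ (π (ι γ)) = f γ := by
    intro γ
    change e₂ (E₁.symm (π (ι γ))) = f γ
    rw [hE₁, MulEquiv.symm_apply_apply]
    rfl
  have hΛinj : Function.Injective Λ := by
    refine (injective_iff_map_eq_one _).2 fun x hx => ?_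
    obtain ⟨y, rfl⟩ := E₁.surjective x
    obtain ⟨γ, rfl⟩ := QuotientGroup.mk_surjective y
    change e₂ (E₁.symm (E₁ _)) = 1 at hx
    rw [MulEquiv.symm_apply_apply] at hx
    change f γ = 1 at hx
    have h1 : (QuotientGroup.mk γ : PuncturedSurfaceGroup g r ⧸ W.comap ι) = 1 := by
      rw [QuotientGroup.eq_one_iff, hWK]; exact hx
    rw [h1, map_one]
  -- the elevation subgroup `N₁ := (Λ ∘ π)⁻¹ N`
  let Nb : Subgroup (P ⧸ W) := N.comap Λ
  let N₁ : Subgroup P := Nb.comap π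
  have hWN₁ : W ≤ N₁ := by
    intro x hx
    rw [Subgroup.mem_comap, Subgroup.mem_comap]
    change Λ (π x) ∈ N
    rw [show π x = 1 from (QuotientGroup.eq_one_iff x).2 hx, map_one]
    exact N.one_mem
  -- `|N₁/W| = |Nb| ≥ |N| ≥ p ^ k`
  have hsurj : Function.Surjective (fun x : Nb => (⟨Λ x.1, x.2⟩ : N)) := by
    rintro ⟨n, hn⟩
    obtain ⟨γ, hγ⟩ := hNle hn
    refine ⟨⟨π (ι γ), ?_⟩, ?_⟩
    · rw [Subgroup.mem_comap, hΛ, hγ]; exact hn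
    · refine Subtype.ext ?_
      show Λ (π (ι γ)) = n
      rw [hΛ, hγ]
  have hcardle : p ^ k ≤ Nat.card Nb := hNcard.trans (Nat.card_le_card_of_surjective _ hsurj)
  have hidx : p ^ k * N₁.index ≤ W.index := by
    rw [Subgroup.index_comap_of_surjective _ (QuotientGroup.mk'_surjective W), W.index_eq_card,
      ← Subgroup.card_mul_index Nb]
    exact Nat.mul_le_mul_right _ hcardle
  refine ⟨W, a, hWo, hWn, hWidx ▸ hKidx, fun j => ?_, N₁, hWN₁, hidx, fun j B hB γ x hx => ?_⟩
  · rw [inter_closure_image_eq W hWo, hWK, inf_comm, ker_inf_cuspInertia_eq f j (hord j)]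
  · -- avoidance: transport to `Q` through `Λ ∘ π`
    obtain ⟨hxN, hxB⟩ := hx
    obtain ⟨y, hy, rfl⟩ := (Subgroup.mem_smul_pointwise_iff_exists _ _ _).1 hxB
    -- the image of `B ⊆ (ι⟨c_j⟩)⁻` in the finite quotient `P/W` lies in `⟨π ι c_j⟩`
    have hyC : π y ∈ Subgroup.zpowers (π (ι (c j))) := by
      have hcl : IsClosed (((Subgroup.zpowers (π (ι (c j)))).comap π : Subgroup P) : Set P) := by
        refine Subgroup.isClosed_of_isOpen _ (Subgroup.isOpen_mono ?_ hWo)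
        intro w hw
        rw [Subgroup.mem_comap, show π w = 1 from (QuotientGroup.eq_one_iff w).2 hw]
        exact Subgroup.one_mem _
      have hsub : ι '' ((cuspInertia (g := g) j : Subgroup (PuncturedSurfaceGroup g r)) :
          Set (PuncturedSurfaceGroup g r)) ⊆
          (((Subgroup.zpowers (π (ι (c j)))).comap π : Subgroup P) : Set P) := by
        rintro _ ⟨δ, hδ, rfl⟩
        rw [SetLike.mem_coe, PuncturedSurfaceGroup.cuspInertia, Subgroup.mem_zpowers_iff] at hδ
        obtain ⟨m, rfl⟩ := hδ
        rw [SetLike.mem_coe, Subgroup.mem_comap, map_zpow, map_zpow]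
        exact ⟨m, rfl⟩
      exact hcl.closure_subset_iff.2 hsub (hB hy)
    have hx' : Λ (π (ConjAct.toConjAct γ • y)) ∈
        N ⊓ ConjAct.toConjAct (Λ (π γ)) • Subgroup.zpowers (f (c j)) := by
      refine ⟨hxN, ?_⟩
      rw [← hΛ, ← MonoidHom.map_zpowers]
      refine (Subgroup.mem_smul_pointwise_iff_exists _ _ _).2 ⟨Λ (π y), ⟨π y, hyC, rfl⟩, ?_⟩
      simp only [ConjAct.smul_def, ConjAct.ofConjAct_toConjAct, map_mul, map_inv]
    rw [hNav j, Subgroup.mem_bot, ← map_one Λ] at hx'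
    exact (QuotientGroup.eq_one_iff _).1 (hΛinj hx')

end Literature.AnabelianGeometry.SemiGraphs.SemiGraphOfAnabelioids.IsProSigmaCompletion

namespace Literature.AnabelianGeometry.SemiGraphs.SemiGraphOfAnabelioids

open CategoryTheory CategoryTheory.PreGaloisCategory Topology Pointwise
open Literature.AnabelianGeometry.Anabelioids
open Literature.GroupTheory.CombinatorialGroupTheory

universe v₁ u₁ u

variable {𝒢 : SemiGraphOfAnabelioids.{v₁, u₁, u}} {Sigma : Set ℕ}

/-! ### At a vertex of surface type -/

/-- **Elevation quotients at a surface-type vertex.** For `𝒢` of surface type, a vertex `v` with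
basepoint `F`, a prime `p ∈ Σ` and `k : ℕ`: an open normal `W ⊴ Π_v` of `p`-power index and a
subgroup `W ⊆ N₁ ⊆ Π_v` with `p ^ k · [Π_v : N₁] ≤ [Π_v : W]`, such that for every branch `b` at `v`
and every basepoint of `𝒢_e` the representative `Π_b` supplied by the surface structure satisfies
`W ∩ Π_b = ((Π_b)^{p^(k+1)})⁻` and `N₁ ∩ γ Π_b γ⁻¹ ⊆ W` for all `γ ∈ Π_v`.
[cite: MochizukiSemiAnbd2006, Ex. 2.10 p.31] -/
theorem IsOfSurfaceType.exists_open_normal_elevated (hS : 𝒢.IsOfSurfaceType Sigma)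
    (v : 𝒢.graph.Vertex) (F : 𝒢.V v ⥤ FintypeCat.{v₁}) [FiberFunctor F] {p : ℕ} (hp : p.Prime)
    (hpS : p ∈ Sigma) (k : ℕ) :
    ∃ (W : Subgroup (Aut F)) (a : ℕ) (N₁ : Subgroup (Aut F)), IsOpen (W : Set (Aut F)) ∧ W.Normal ∧
      W.index ∣ p ^ a ∧ W ≤ N₁ ∧ p ^ k * N₁.index ≤ W.index ∧
      ∀ (b : {b : 𝒢.graph.Branch // 𝒢.graph.abuts b = some v})
        (Fe : 𝒢.E (𝒢.graph.edgeOf b.1) ⥤ FintypeCat.{v₁}) [FiberFunctor Fe],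
        ∃ α : (𝒢.pull b.1 v b.2).pullback ⋙ Fe ≅ F,
          (W : Set (Aut F)) ∩ (𝒢.branchSubgroup F b.1 b.2 Fe α : Set (Aut F)) =
            closure ((fun x : Aut F => x ^ p ^ (k + 1)) ''
              (𝒢.branchSubgroup F b.1 b.2 Fe α : Set (Aut F))) ∧
          ∀ γ : Aut F, N₁ ⊓ ConjAct.toConjAct γ • 𝒢.branchSubgroup F b.1 b.2 Fe α ≤ W := by
  obtain ⟨g, r, ι, hh, hι, js, -, hbr⟩ := hS.vertex v F
  obtain ⟨W, a, hWo, hWn, hWidx, hWcusp, N₁, hWN₁, hidx, hav⟩ :=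
    hι.exists_open_normal_elevated hh hp hpS k
  refine ⟨W, a, N₁, hWo, hWn, hWidx, hWN₁, hidx, fun b Fe _ => ?_⟩
  obtain ⟨α, hα⟩ := hbr b Fe
  refine ⟨α, ?_, fun γ => hav (js b) _ hα.subset γ⟩
  rw [hα, hWcusp (js b), PuncturedSurfaceGroup.cuspInertia]
  exact IsProSigmaCompletion.closure_image_zpowers_pow ι _ _

/-! ### Compatibility of vertex and edge quotients along a branch -/

/-- **The edge quotient determined by a uniform branch order.** For `𝒢` of injective type, a
vertex basepoint `F`, a normal subgroup `W ⊴ Π_v` and a representative `Π_b = ψ(Π_e)`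
(`ψ = (α-conjugation) ∘ π₁(b^*)`, a closed embedding) with `W ∩ Π_b = ((Π_b)^n)⁻`: the closed normal
subgroup of `Π_e` generated by the `n`-th powers is exactly `ψ⁻¹(W)` — so the quotient
`Π_e ↠ Π_e/ψ⁻¹(W)` is intrinsic to `Π_e` and agrees for both branches of `e`.
[cite: MochizukiSemiAnbd2006, Ex. 2.10 p.31] -/
theorem compat_of_inter_branchSubgroup (hinj : 𝒢.IsOfInjectiveType) {v : 𝒢.graph.Vertex}
    (F : 𝒢.V v ⥤ FintypeCat.{v₁}) [FiberFunctor F] (W : Subgroup (Aut F)) [W.Normal] (n : ℕ)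
    (b : 𝒢.graph.Branch) (h : 𝒢.graph.abuts b = some v)
    (Fe : 𝒢.E (𝒢.graph.edgeOf b) ⥤ FintypeCat.{v₁}) [FiberFunctor Fe]
    (α : (𝒢.pull b v h).pullback ⋙ Fe ≅ F)
    (hα : (W : Set (Aut F)) ∩ (𝒢.branchSubgroup F b h Fe α : Set (Aut F)) =
      closure ((fun x : Aut F => x ^ n) '' (𝒢.branchSubgroup F b h Fe α : Set (Aut F)))) :
    (Subgroup.normalClosure ((fun x : Aut Fe => x ^ n) '' Set.univ)).topologicalClosure =
      W.comap ((Aut.autMulEquivOfIso α).toMonoidHom.comp (pi1Map (𝒢.pull b v h).pullback Fe)) := by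
  set ψ := (Aut.autMulEquivOfIso α).toMonoidHom.comp (pi1Map (𝒢.pull b v h).pullback Fe) with hψ
  obtain ⟨hψc, hψi⟩ := branchHom_continuous_injective hinj F b h Fe α
  have hemb : IsClosedEmbedding ψ := hψc.isClosedEmbedding hψi
  -- the branch subgroup is the range of `ψ`
  have hB : (𝒢.branchSubgroup F b h Fe α : Set (Aut F)) = Set.range ψ := by
    rw [hψ]; exact (MonoidHom.coe_range _)
  -- `ψ⁻¹(W) = closure of the n-th powers`, as sets
  have hset : (W.comap ψ : Set (Aut Fe)) = closure ((fun x : Aut Fe => x ^ n) '' Set.univ) := by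
    have himg : (fun x : Aut F => x ^ n) '' Set.range ψ =
        ψ '' ((fun x : Aut Fe => x ^ n) '' Set.univ) := by
      ext y
      constructor
      · rintro ⟨_, ⟨x, rfl⟩, rfl⟩; exact ⟨x ^ n, ⟨x, Set.mem_univ _, rfl⟩, map_pow ψ x n⟩
      · rintro ⟨_, ⟨x, -, rfl⟩, rfl⟩; exact ⟨ψ x, ⟨x, rfl⟩, (map_pow ψ x n).symm⟩
    ext x
    rw [Subgroup.coe_comap, Set.mem_preimage, SetLike.mem_coe]
    constructor
    · intro hx
      have hx' : ψ x ∈ (W : Set _) ∩ (𝒢.branchSubgroup F b h Fe α : Set _) :=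
        ⟨hx, by rw [hB]; exact ⟨x, rfl⟩⟩
      rw [hα, hB, himg, hemb.closure_image_eq] at hx'
      obtain ⟨x', hx', hxx'⟩ := hx'
      rwa [← hψi hxx']
    · intro hx
      have : ψ x ∈ closure ((fun y : Aut F => y ^ n) ''
          (𝒢.branchSubgroup F b h Fe α : Set _)) := by
        rw [hB, himg, hemb.closure_image_eq]
        exact ⟨x, hx, rfl⟩
      rw [← hα] at this
      exact this.1
  apply le_antisymm
  · refine Subgroup.topologicalClosure_minimal _ (Subgroup.normalClosure_le_normal ?_) ?_
    · intro y hy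
      rw [SetLike.mem_coe, ← SetLike.mem_coe, hset]
      exact subset_closure hy
    · rw [hset]; exact isClosed_closure
  · intro x hx
    rw [← SetLike.mem_coe, hset] at hx
    exact closure_mono (Subgroup.subset_normalClosure) hx |> fun h' => by
      rw [← Subgroup.topologicalClosure_coe] at h'; exact h'

/-- Images of conjugates are conjugates of images. [folklore] -/
private theorem map_toConjAct_smul {G H : Type*} [Group G] [Group H] (f : G →* H) (γ : G)
    (K : Subgroup G) : (ConjAct.toConjAct γ • K).map f = ConjAct.toConjAct (f γ) • K.map f := by
  ext x
  constructor
  · rintro ⟨y, hy, rfl⟩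
    obtain ⟨s, hs, rfl⟩ := (Subgroup.mem_smul_pointwise_iff_exists _ _ _).1 hy
    refine (Subgroup.mem_smul_pointwise_iff_exists _ _ _).2 ⟨f s, ⟨s, hs, rfl⟩, ?_⟩
    simp only [ConjAct.smul_def, ConjAct.ofConjAct_toConjAct, map_mul, map_inv]
  · intro hx
    obtain ⟨_, ⟨s, hs, rfl⟩, rfl⟩ := (Subgroup.mem_smul_pointwise_iff_exists _ _ _).1 hx
    refine ⟨ConjAct.toConjAct γ • s, Subgroup.smul_mem_pointwise_smul _ _ _ hs, ?_⟩
    simp only [ConjAct.smul_def, ConjAct.ofConjAct_toConjAct, map_mul, map_inv]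

/-! ### Total elevation -/

/-- **[SemiAnbd] Ex. 2.10 (2)**: a semi-graph of anabelioids of surface type in which every edge
abuts to a vertex is totally elevated ([SemiAnbd] Def. 2.4 (i)).
[cite: MochizukiSemiAnbd2006, Ex. 2.10 p.31] -/
theorem isTotallyElevated_of_isOfSurfaceType (hE : 𝒢.EveryEdgeAbuts)
    (hS : 𝒢.IsOfSurfaceType Sigma) : 𝒢.IsTotallyElevated := by
  classical
  refine ⟨fun v₀ M hM => ?_⟩
  -- basepoints everywhere
  choose Fv hFv using fun w : 𝒢.graph.Vertex => GaloisCategory.hasFiberFunctor (C := 𝒢.V w)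
  haveI : ∀ w, FiberFunctor (Fv w) := fun w => (hFv w).some
  choose Fe hFe using fun e : 𝒢.graph.Edge => GaloisCategory.hasFiberFunctor (C := 𝒢.E e)
  haveI : ∀ e, FiberFunctor (Fe e) := fun e => (hFe e).some
  -- (a) the exponent `n = p ^ (k+1)`, `p ∈ Σ`, `p ^ k ≥ M`
  obtain ⟨⟨p, hpS⟩, hprimes⟩ := hS.sigma_primes
  have hp : p.Prime := hprimes p hpS
  set k := M with hk
  have hMk : M ≤ p ^ k := (Nat.lt_pow_self hp.one_lt).le
  let n : ℕ := p ^ (k + 1)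
  have hn : IsSigmaInteger Sigma n := IsProSigmaCompletion.isSigmaInteger_prime_pow hp hpS (k + 1)
  -- (b) the elevation quotient at `v₀`, the uniform cusp-order quotients elsewhere
  obtain ⟨W₀, a, N₀, hW₀o, hW₀n, hW₀idx, hW₀N, hidx₀, hW₀B⟩ :=
    hS.exists_open_normal_elevated v₀ (Fv v₀) hp hpS k
  let M' : ℕ := n ^ 3 * p ^ a
  have hM' : 1 ≤ M' :=
    Nat.one_le_iff_ne_zero.2 (Nat.mul_ne_zero (pow_ne_zero 3 hn.1.ne') (pow_ne_zero a hp.ne_zero))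
  have hWall : ∀ w : 𝒢.graph.Vertex, ∃ W : Subgroup (Aut (Fv w)), IsOpen (W : Set (Aut (Fv w))) ∧
      W.Normal ∧ W.index ∣ M' ∧
      (∀ (b : {b : 𝒢.graph.Branch // 𝒢.graph.abuts b = some w})
        (Fe' : 𝒢.E (𝒢.graph.edgeOf b.1) ⥤ FintypeCat.{v₁}) [FiberFunctor Fe'],
        ∃ α : (𝒢.pull b.1 w b.2).pullback ⋙ Fe' ≅ Fv w,
          (W : Set (Aut (Fv w))) ∩ (𝒢.branchSubgroup (Fv w) b.1 b.2 Fe' α : Set (Aut (Fv w))) =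
            closure ((fun x : Aut (Fv w) => x ^ n) ''
              (𝒢.branchSubgroup (Fv w) b.1 b.2 Fe' α : Set (Aut (Fv w))))) ∧
      (w = v₀ → ∃ N₁ : Subgroup (Aut (Fv w)), W ≤ N₁ ∧ p ^ k * N₁.index ≤ W.index ∧
        ∀ (b : {b : 𝒢.graph.Branch // 𝒢.graph.abuts b = some w})
          (Fe' : 𝒢.E (𝒢.graph.edgeOf b.1) ⥤ FintypeCat.{v₁}) [FiberFunctor Fe'],
          ∃ α : (𝒢.pull b.1 w b.2).pullback ⋙ Fe' ≅ Fv w, ∀ γ : Aut (Fv w),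
            N₁ ⊓ ConjAct.toConjAct γ • 𝒢.branchSubgroup (Fv w) b.1 b.2 Fe' α ≤ W) := by
    intro w
    rcases eq_or_ne w v₀ with rfl | hw
    · exact ⟨W₀, hW₀o, hW₀n, hW₀idx.trans (dvd_mul_left _ _),
        fun b Fe' _ => (hW₀B b Fe').imp fun α hα => hα.1,
        fun _ => ⟨N₀, hW₀N, hidx₀, fun b Fe' _ => (hW₀B b Fe').imp fun α hα => hα.2⟩⟩
    · haveI : (⊤ : Subgroup (Aut (Fv w))).Normal := inferInstance
      obtain ⟨W, hWo, hWn, -, hWidx, hWB⟩ := hS.exists_open_normal_inter_branchSubgroup w (Fv w) hn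
        ⊤ (by rw [Subgroup.coe_top]; exact isOpen_univ) (fun x => Subgroup.mem_top x)
      rw [Subgroup.index_top, one_mul] at hWidx
      exact ⟨W, hWo, hWn, hWidx.trans (dvd_mul_right _ _), hWB, fun h => absurd h hw⟩
  choose W hWo hWn hWidx hWB hWel using hWall
  -- (c) edges: the closed normal subgroup generated by the `n`-th powers
  let N : ∀ e : 𝒢.graph.Edge, Subgroup (Aut (Fe e)) := fun e =>
    (Subgroup.normalClosure ((fun x : Aut (Fe e) => x ^ n) '' Set.univ)).topologicalClosure
  have hNn : ∀ e, (N e).Normal := fun e => Subgroup.is_normal_topologicalClosure _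
  have hcompat : ∀ (b : 𝒢.graph.Branch) (v : 𝒢.graph.Vertex) (h : 𝒢.graph.abuts b = some v),
      ∃ α : (𝒢.pull b v h).pullback ⋙ Fe (𝒢.graph.edgeOf b) ≅ Fv v,
        N (𝒢.graph.edgeOf b) = (W v).comap ((Aut.autMulEquivOfIso α).toMonoidHom.comp
          (pi1Map (𝒢.pull b v h).pullback (Fe (𝒢.graph.edgeOf b)))) := by
    intro b v h
    obtain ⟨α, hα⟩ := hWB v ⟨b, h⟩ (Fe (𝒢.graph.edgeOf b))
    haveI := hWn v
    exact ⟨α, compat_of_inter_branchSubgroup hS.isOfInjectiveType (Fv v) (W v) n b h _ α hα⟩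
  have hNo : ∀ e, IsOpen (N e : Set (Aut (Fe e))) := by
    intro e
    obtain ⟨b, v, hbe, h⟩ := hE e
    subst hbe
    obtain ⟨α, hN⟩ := hcompat b v h
    obtain ⟨hψc, -⟩ := branchHom_continuous_injective hS.isOfInjectiveType (Fv v) b h
      (Fe (𝒢.graph.edgeOf b)) α
    rw [hN, Subgroup.coe_comap]
    exact (hWo v).preimage hψc
  -- (d) the quotient approximator with its branch subgroups
  obtain ⟨𝒢', φ, happ, -, -, hcard, hbranch⟩ := 𝒢.exists_quotientApproximator_branches Fv W hWo
    hWn Fe N hNo hNn hcompat M' hM' hWidx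
  refine ⟨𝒢', φ, happ, fun F' _ => ?_⟩
  obtain ⟨θ, -, hθs, hθk, hθB⟩ := hbranch v₀ F'
  obtain ⟨N₁, hWN₁, hidx, hav⟩ := hWel v₀ rfl
  haveI : Finite (Aut F') := (hcard v₀ F').1
  -- (e) the elevation subgroup `θ(N₁) ⊆ Aut F' = Π_{v₀}/W_{v₀}`
  refine ⟨N₁.map θ, inferInstance, ?_, fun b h Fe' _ α' g₁ => ?_⟩
  · have hWi : (W v₀).index ≠ 0 := ne_zero_of_dvd_ne_zero (Nat.one_le_iff_ne_zero.1 hM') (hWidx v₀)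
    have hN₁i : N₁.index ≠ 0 := ne_zero_of_dvd_ne_zero hWi (Subgroup.index_dvd_of_le hWN₁)
    have hmi : (N₁.map θ).index = N₁.index :=
      Subgroup.index_map_eq _ hθs (by rw [hθk]; exact hWN₁)
    have hc : Nat.card (N₁.map θ) * N₁.index = (W v₀).index := by
      rw [← hmi, Subgroup.card_mul_index, (hcard v₀ F').2]
    refine Nat.le_of_mul_le_mul_right ?_ (Nat.pos_of_ne_zero hN₁i)
    rw [hc]
    exact (Nat.mul_le_mul_right _ hMk).trans hidx
  · obtain ⟨b₀, h₀, hb₀⟩ := hθB b h Fe' α'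
    obtain ⟨α₀, hα₀⟩ := hav ⟨b₀, h₀⟩ (Fe (𝒢.graph.edgeOf b₀))
    obtain ⟨g₀, hg₀⟩ := hb₀ α₀
    obtain ⟨γ, hγ⟩ := hθs (g₁ * g₀)
    rw [hg₀, smul_smul, ← map_mul, ← hγ, ← map_toConjAct_smul, eq_bot_iff]
    rintro x ⟨⟨x₁, hx₁, rfl⟩, ⟨y, hy, hxy⟩⟩
    have hW : x₁⁻¹ * y ∈ W v₀ := by
      rw [← hθk, MonoidHom.mem_ker, map_mul, map_inv, hxy, inv_mul_cancel]
    have hyN : y ∈ N₁ := by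
      have := N₁.mul_mem hx₁ (hWN₁ hW)
      rwa [mul_inv_cancel_left] at this
    have hyW : y ∈ θ.ker := by rw [hθk]; exact hα₀ γ ⟨hyN, hy⟩
    rw [Subgroup.mem_bot, ← hxy]
    exact MonoidHom.mem_ker.1 hyW

/-- **[SemiAnbd] Ex. 2.10, conjunct (2) of the named fact `example_2_10`** (with the binder
`EveryEdgeAbuts` of ruling σ2). [cite: MochizukiSemiAnbd2006, Ex. 2.10 p.31] -/
theorem example_2_10_totallyElevated_of :
    ∀ (𝒢 : SemiGraphOfAnabelioids.{v₁, u₁, u}) (Sigma : Set ℕ), 𝒢.EveryEdgeAbuts →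
      𝒢.IsOfSurfaceType Sigma → 𝒢.IsTotallyElevated :=
  fun _ _ hE hS => isTotallyElevated_of_isOfSurfaceType hE hS

end Literature.AnabelianGeometry.SemiGraphs.SemiGraphOfAnabelioids
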